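import Mathlib
import HarnessLib
import Literature.Probability.Percolation.MinOpenCut
import Literature.Probability.Percolation.MinOpenCutMenger
import Literature.Probability.Percolation.SharpnessDCTProofs
import Literature.Probability.Percolation.LatticeSymmetry
import Literature.Probability.Percolation.SitePaths
import Literature.Probability.Percolation.StraightCylinderCuts

/-!
# `stub_tauLimit` of line `Sketch` (crux `BudgetTightness`, stmt-CriticalPhenomena-5248):
# Kesten's slab flow constant `τ_h(p) = lim_L E_p[S(L,h)]/(L+1)²` exists and is the supremum

Registered stub of the lead's skeleton `Cruxes/BudgetTightness/Lines/Sketch.lean`, proved DEF-FREE.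
`S(L,h)(ω) = minOpenCutIn Q(L,h) bottom top ω` is the bottom-to-top min-cut budget (`MinOpenCut.lean`)
of the slab piece `Q(L,h) = [0,L]² × [0,h] ⊆ ℤ³`, `f(L) = E_p[S(L,h)] = ∫ (S(L,h) ω).toNat ∂P_p`; claim:
some `τ ∈ ℝ` has `f(L) ≤ τ (L+1)²` for every `L` and `f(L)/(L+1)² → τ` (Fekete in two dimensions with
monotonicity, `tendsto_of_mono_superadd`). For `h = 0` bottom = top, every budget is `⊤`, `f ≡ 0`, `τ = 0`.
For `h ≥ 1`: (i) `f` is non-decreasing (`minOpenCutIn_mono_set/_left/_right`); (ii) `k² f(L) ≤ f(k(L+1)-1)`: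
the `k²` translates `((L+1)a, (L+1)b, 0) + Q(L,h)`, `a, b < k`, are disjoint full-height sub-pieces of
`Q(k(L+1)-1, h)`, so their budgets add up to at most the big one (`sum_minOpenCutIn_le`, as in
`stub_superadditive`), each of expectation `f(L)` (`bondPercolation_map_shift`); (iii) `f(L) ≤ (L+1)²`:
on lattice configurations the `(L+1)²` vertical edges `{(a,b,0),(a,b,1)}` form an open cutset.
-/

noncomputable section

namespace Summit.CriticalPhenomena.PercolationContinuityZ3.Theorems.BudgetTightness

open MeasureTheory ProbabilityTheory Filter
open Literature.Probability.Percolation Literature.Probability.LatticeModels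

/-- `S⟦L, h⟧ = S(L,h)`: the bottom-to-top min-cut budget of the piece `[0,L]² × [0,h]` (notation). -/
local notation3 (prettyPrint := false) "S⟦" L ", " h "⟧" => minOpenCutIn
    (Set.Icc (![0, 0, 0] : Site 3) ![((L : ℕ) : ℤ), ((L : ℕ) : ℤ), ((h : ℕ) : ℤ)])
    (Set.Icc (![0, 0, 0] : Site 3) ![((L : ℕ) : ℤ), ((L : ℕ) : ℤ), 0])
    (Set.Icc (![0, 0, ((h : ℕ) : ℤ)] : Site 3) ![((L : ℕ) : ℤ), ((L : ℕ) : ℤ), ((h : ℕ) : ℤ)])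

/-- `B⟦L, h, a, b⟧`: budget of the block `((L+1)a, (L+1)b, 0) + [0,L]² × [0,h]` (as in `stub_superadditive`). -/
local notation3 (prettyPrint := false) "B⟦" L ", " h ", " a ", " b "⟧" => minOpenCutIn
    (Set.Icc (![(((L + 1) * a : ℕ) : ℤ), (((L + 1) * b : ℕ) : ℤ), 0] : Site 3)
      ![(((L + 1) * a + L : ℕ) : ℤ), (((L + 1) * b + L : ℕ) : ℤ), ((h : ℕ) : ℤ)])
    (Set.Icc (![(((L + 1) * a : ℕ) : ℤ), (((L + 1) * b : ℕ) : ℤ), 0] : Site 3)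
      ![(((L + 1) * a + L : ℕ) : ℤ), (((L + 1) * b + L : ℕ) : ℤ), 0])
    (Set.Icc (![(((L + 1) * a : ℕ) : ℤ), (((L + 1) * b : ℕ) : ℤ), ((h : ℕ) : ℤ)] : Site 3)
      ![(((L + 1) * a + L : ℕ) : ℤ), (((L + 1) * b + L : ℕ) : ℤ), ((h : ℕ) : ℤ)])

/-- `E⟦p, L, h⟧ = E_p[S(L,h)]` (notation). -/
local notation3 (prettyPrint := false) "E⟦" p ", " L ", " h "⟧" =>
  ∫ ω, ((S⟦L, h⟧ ω).toNat : ℝ) ∂(bondPercolation (zdGraph 3) p)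

namespace StubTauLimit

/-- **Fekete in two dimensions with monotonicity.** If `f ≥ 0` is non-decreasing, `k² f(L) ≤ f(k(L+1)-1)`
and `f(L) ≤ (L+1)²`, then `τ := sup_L f(L)/(L+1)²` bounds every term and `f(L)/(L+1)² → τ`
(for `N + 1 = k(L₀+1) + r`: `f(N)/(N+1)² ≥ (k/(k+1))² f(L₀)/(L₀+1)²`). -/
theorem tendsto_of_mono_superadd {f : ℕ → ℝ} (h0 : ∀ L, 0 ≤ f L) (hmono : Monotone f)
    (hsup : ∀ k L : ℕ, (k : ℝ) ^ 2 * f L ≤ f (k * (L + 1) - 1))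
    (hbdd : ∀ L, f L ≤ ((L : ℝ) + 1) ^ 2) :
    ∃ τ : ℝ, (∀ L, f L ≤ τ * ((L : ℝ) + 1) ^ 2) ∧
      Tendsto (fun L => f L / ((L : ℝ) + 1) ^ 2) atTop (nhds τ) := by
  have hpos : ∀ L : ℕ, (0 : ℝ) < ((L : ℝ) + 1) ^ 2 := fun L => by positivity
  obtain ⟨τ, hτ⟩ : ∃ τ, IsLUB (Set.range fun L : ℕ => f L / ((L : ℝ) + 1) ^ 2) τ :=
    ⟨_, isLUB_ciSup ⟨1, by rintro _ ⟨L, rfl⟩; exact (div_le_one (hpos L)).2 (hbdd L)⟩⟩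
  have hle : ∀ L, f L / ((L : ℝ) + 1) ^ 2 ≤ τ := fun L => hτ.1 ⟨L, rfl⟩
  refine ⟨τ, fun L => (div_le_iff₀ (hpos L)).1 (hle L), tendsto_order.2
    ⟨fun a ha => ?_, fun b hb => Eventually.of_forall fun L => (hle L).trans_lt hb⟩⟩
  obtain ⟨_, ⟨L₀, rfl⟩, hL₀⟩ := (lt_isLUB_iff hτ).1 ha
  have hlim : Tendsto (fun k : ℕ => ((k : ℝ) / ((k : ℝ) + 1)) ^ 2 *
      (f L₀ / ((L₀ : ℝ) + 1) ^ 2)) atTop (nhds (f L₀ / ((L₀ : ℝ) + 1) ^ 2)) := by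
    simpa using ((tendsto_natCast_div_add_atTop (1 : ℝ)).pow 2).mul_const
      (f L₀ / ((L₀ : ℝ) + 1) ^ 2)
  obtain ⟨K, hK⟩ := eventually_atTop.1 (hlim.eventually_const_lt hL₀)
  refine eventually_atTop.2 ⟨K * (L₀ + 1) + L₀, fun N hN => ?_⟩
  obtain ⟨k, hk1, hk2, hKk⟩ : ∃ k : ℕ, k * (L₀ + 1) ≤ N + 1 ∧
      N + 1 < k * (L₀ + 1) + (L₀ + 1) ∧ K ≤ k :=
    ⟨(N + 1) / (L₀ + 1), Nat.div_mul_le_self _ _, Nat.lt_div_mul_add (by omega),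
      (Nat.le_div_iff_mul_le (by omega)).2 (by omega)⟩
  have hNk : (N : ℝ) + 1 ≤ ((k : ℝ) + 1) * ((L₀ : ℝ) + 1) := by
    have h2 := (Nat.cast_le (α := ℝ)).2 hk2.le; push_cast at h2; linarith
  refine (hK k hKk).trans_le ?_
  rw [div_pow, div_mul_div_comm]
  refine div_le_div₀ (h0 N) ((hsup k L₀).trans (hmono (by omega))) (hpos N) ?_
  rw [← mul_pow]; exact pow_le_pow_left₀ (by positivity) hNk 2

-- adapted from Theorems/PercBudgetLadderBudgetTightnessStubSuperadditive.lean
/-- **Superadditivity of the budget over pairwise disjoint sub-regions** `S i ⊆ S'` (`A i ⊆ A'`,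
`B i ⊆ B'`): `∑_{i ∈ s} MinCut_{S i}(A i, B i)(ω) ≤ MinCut_{S'}(A', B')(ω)` (restrict an optimal cutset). -/
theorem sum_minOpenCutIn_le {V ι : Type*} {s : Finset ι} {S A B : ι → Set V} {S' A' B' : Set V}
    {ω : BondConfig V} (hS : ∀ i ∈ s, S i ⊆ S') (hA : ∀ i ∈ s, A i ⊆ A')
    (hB : ∀ i ∈ s, B i ⊆ B') (hdisj : (↑s : Set ι).PairwiseDisjoint S) :
    ∑ i ∈ s, minOpenCutIn (S i) (A i) (B i) ω ≤ minOpenCutIn S' A' B' ω := by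
  classical
  by_cases htop : minOpenCutIn S' A' B' ω = ⊤
  · rw [htop]; exact le_top
  obtain ⟨T, hT, hcard⟩ := exists_eq_minOpenCutIn htop
  have hcut : ∀ i ∈ s, IsOpenCutsetIn (S i) (A i) (B i) ω ↑(T.filter (· ∈ (S i).sym2)) :=
    fun i hi => by
    rw [Finset.coe_filter]
    exact isOpenCutsetIn_inter_sym2_iff.2 ((hT.anti_set (hS i hi)).anti (hA i hi) (hB i hi))
  have hdisjT : (↑s : Set ι).PairwiseDisjoint fun i => T.filter (· ∈ (S i).sym2) := by
    intro i hi j hj hij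
    rw [Function.onFun, Finset.disjoint_filter]
    intro e _ hei hej
    induction e using Sym2.ind with
    | h u v =>
      exact Set.disjoint_left.1 (hdisj hi hj hij) (Set.mk_mem_sym2_iff.1 hei).1
        (Set.mk_mem_sym2_iff.1 hej).1
  calc ∑ i ∈ s, minOpenCutIn (S i) (A i) (B i) ω
      ≤ ∑ i ∈ s, ((T.filter (· ∈ (S i).sym2)).card : ℕ∞) :=
        Finset.sum_le_sum fun i hi => minOpenCutIn_le_card (hcut i hi)
    _ = ((s.biUnion fun i => T.filter (· ∈ (S i).sym2)).card : ℕ) := by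
        rw [Finset.card_biUnion hdisjT, Nat.cast_sum]
    _ ≤ T.card := by
        exact_mod_cast Finset.card_le_card (Finset.biUnion_subset.2 fun i _ => Finset.filter_subset _ _)
    _ = minOpenCutIn S' A' B' ω := hcard

-- the next four proofs are adapted from Theorems/PercBudgetLadderBudgetTightnessStubPatchCutset.lean
/-- **Transport of the budget along a bijection, `≤`**: `φ '' ·` carries cutsets to cutsets. -/
theorem minOpenCutIn_image_relabel_le {V W : Type*} (φ : V ≃ W) (S A B : Set V)
    (ω : BondConfig V) :
    minOpenCutIn (φ '' S) (φ '' A) (φ '' B) (BondConfig.relabel (sym2Equiv φ) ω) ≤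
      minOpenCutIn S A B ω := by
  classical
  refine le_iInf₂ fun T hT => ?_
  have hT' : IsOpenCutsetIn (φ '' S) (φ '' A) (φ '' B) (BondConfig.relabel (sym2Equiv φ) ω)
      ↑(T.image (sym2Equiv φ)) := by
    rintro _ ⟨x, hx, rfl⟩ _ ⟨y, hy, rfl⟩ hconn
    have h := relabel_mem_openConnIn φ.symm hconn
    have key : BondConfig.relabel (sym2Equiv φ.symm)
        (BondConfig.relabel (sym2Equiv φ) ω \ ↑(T.image (sym2Equiv φ))) = ω \ ↑T := by
      rw [BondConfig.relabel_apply, BondConfig.relabel_apply, Finset.coe_image,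
        ← Set.image_sdiff (sym2Equiv φ).injective, ← sym2Equiv_symm, Equiv.symm_image_image]
    rw [key, Equiv.symm_image_image, Equiv.symm_apply_apply, Equiv.symm_apply_apply] at h
    exact hT x hx y hy h
  exact (minOpenCutIn_le_card hT').trans_eq
    (by rw [Finset.card_image_of_injective _ (sym2Equiv φ).injective])

/-- **Transport of the budget along a bijection**: `MinCut_{φ S}(φ A, φ B)(φ '' ω) = MinCut_S(A, B)(ω)`. -/
theorem minOpenCutIn_image_relabel {V W : Type*} (φ : V ≃ W) (S A B : Set V) (ω : BondConfig V) :
    minOpenCutIn (φ '' S) (φ '' A) (φ '' B) (BondConfig.relabel (sym2Equiv φ) ω) =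
      minOpenCutIn S A B ω := by
  refine le_antisymm (minOpenCutIn_image_relabel_le φ S A B ω) ?_
  have h := minOpenCutIn_image_relabel_le φ.symm (φ '' S) (φ '' A) (φ '' B)
    (BondConfig.relabel (sym2Equiv φ) ω)
  rwa [Equiv.symm_image_image, Equiv.symm_image_image, Equiv.symm_image_image,
    relabel_symm_relabel] at h

/-- **Measurability of the real-valued budget on a finite region** (`measurableSet_setOf_minOpenCutIn_le`). -/
theorem measurable_toNat_minOpenCutIn {V : Type*} {S : Set V} (hS : S.Finite) (A B : Set V) :
    Measurable fun ω => ((minOpenCutIn S A B ω).toNat : ℝ) := by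
  have hle : ∀ z : ℕ∞, MeasurableSet {ω | minOpenCutIn S A B ω ≤ z} := fun z => by
    induction z using ENat.recTopCoe with
    | top => simp
    | coe k => exact measurableSet_setOf_minOpenCutIn_le hS A B k
  refine (measurable_of_countable fun j : ℕ => (j : ℝ)).comp
    ((measurable_of_countable ENat.toNat).comp (measurable_to_countable' fun z => ?_))
  have : minOpenCutIn S A B ⁻¹' {z} =
      {ω | minOpenCutIn S A B ω ≤ z} \ ⋃ w ∈ {w | w < z}, {ω | minOpenCutIn S A B ω ≤ w} := by
    ext ω
    simp only [Set.mem_preimage, Set.mem_singleton_iff, Set.mem_sdiff, Set.mem_setOf_eq,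
      Set.mem_iUnion, exists_prop, not_exists, not_and]
    exact ⟨fun h => ⟨h.le, fun w hw hle' => absurd (hle'.trans_lt hw) (h ▸ lt_irrefl _)⟩,
      fun h => le_antisymm h.1 (not_lt.1 fun hlt => h.2 _ hlt le_rfl)⟩
  rw [this]
  exact (hle z).diff (MeasurableSet.biUnion (Set.to_countable _) fun w _ => hle w)

/-- **Translation invariance on `ℤ^d`**: `E_p[MinCut_{S + c}(A + c, B + c)] = E_p[MinCut_S(A, B)]`. -/
theorem integral_toNat_minOpenCutIn_shift {d : ℕ} (p : unitInterval) (c : Site d)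
    (S A B : Set (Site d)) :
    ∫ ω, ((minOpenCutIn ((· + c) '' S) ((· + c) '' A) ((· + c) '' B) ω).toNat : ℝ)
        ∂(bondPercolation (zdGraph d) p) =
      ∫ ω, ((minOpenCutIn S A B ω).toNat : ℝ) ∂(bondPercolation (zdGraph d) p) := by
  nth_rw 1 [← bondPercolation_map_shift c p]
  rw [integral_map_equiv]
  simp_rw [show ∀ ω, minOpenCutIn ((· + c) '' S) ((· + c) '' A) ((· + c) '' B)
      (BondConfig.relabel (sym2Equiv (Site.shift c)) ω) = minOpenCutIn S A B ω from
    fun ω => minOpenCutIn_image_relabel (Site.shift c) S A B ω]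

/-- Coordinatewise comparison of corner vectors of `ℤ³`. -/
theorem vec3_le {a0 a1 a2 b0 b1 b2 : ℤ} (h0 : a0 ≤ b0) (h1 : a1 ≤ b1) (h2 : a2 ≤ b2) :
    (![a0, a1, a2] : Site 3) ≤ ![b0, b1, b2] := fun i => by
  fin_cases i; exacts [h0, h1, h2]

/-- For `h ≥ 1` the budget `S(L,h)(ω)` is finite (bottom and top layers are disjoint). -/
theorem sl_ne_top {h : ℕ} (hh : 1 ≤ h) (L : ℕ) (ω : BondConfig (Site 3)) : S⟦L, h⟧ ω ≠ ⊤ := by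
  rw [Ne, minOpenCutIn_eq_top_iff_of_finite (Set.finite_Icc _ _)]
  rintro ⟨a, -, ha, ha'⟩
  have h1 : a 2 ≤ 0 := ha.2 2
  have h2 : (h : ℤ) ≤ a 2 := ha'.1 2
  omega

/-- `S(L,h)(ω) ≤ S(L',h)(ω)` for `L ≤ L'` (`minOpenCutIn_mono_set/_left/_right`: everything grows). -/
theorem sl_mono {L L' : ℕ} (hL : L ≤ L') (h : ℕ) (ω : BondConfig (Site 3)) :
    S⟦L, h⟧ ω ≤ S⟦L', h⟧ ω := by
  have hL' : (L : ℤ) ≤ L' := Nat.cast_le.2 hL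
  have hsub : ∀ lo hi : ℤ, Set.Icc (![0, 0, lo] : Site 3) ![(L : ℤ), (L : ℤ), hi] ⊆
      Set.Icc (![0, 0, lo] : Site 3) ![(L' : ℤ), (L' : ℤ), hi] :=
    fun lo hi => Set.Icc_subset_Icc le_rfl (vec3_le hL' hL' le_rfl)
  exact (minOpenCutIn_mono_set (hsub 0 h)).trans
    ((minOpenCutIn_mono_left (hsub 0 0)).trans (minOpenCutIn_mono_right (hsub h h)))

/-- **Layer cutset.** On a lattice configuration `ω ⊆ E(ℤ³)` (`h ≥ 1`) the `(L+1)²` vertical edges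
`{(a,b,0), (a,b,1)}` cut the piece: an open bottom-to-top path first leaves `{x₂ ≤ 0}` along one. -/
theorem sl_le_sq {L h : ℕ} (hh : 1 ≤ h) {ω : BondConfig (Site 3)}
    (hω : ω ⊆ (zdGraph 3).edgeSet) : S⟦L, h⟧ ω ≤ ((L + 1) ^ 2 : ℕ) := by
  classical
  have hcard : ((Finset.range (L + 1) ×ˢ Finset.range (L + 1)).image fun ab : ℕ × ℕ =>
      s((![(ab.1 : ℤ), (ab.2 : ℤ), 0] : Site 3), ![(ab.1 : ℤ), (ab.2 : ℤ), 1])).card ≤ (L + 1) ^ 2 :=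
    Finset.card_image_le.trans (by rw [Finset.card_product, Finset.card_range, sq])
  refine (minOpenCutIn_le_card fun x hx y hy hconn => ?_).trans (Nat.cast_le.2 hcard)
  have hy2 : (h : ℤ) ≤ y 2 := hy.1 2
  obtain ⟨a, b, haR, hbR, -, hab, hpa⟩ := (DCT16.pathIn_of_mem_openConnIn hconn).exit
    (show x ∈ {v : Site 3 | v 2 ≤ 0} from hx.2 2) (fun hy0 : y 2 ≤ 0 => by omega)
  have haQ := hpa.right_mem.2
  obtain ⟨ha0, ha1, haL0, haL1⟩ : (0 : ℤ) ≤ a 0 ∧ (0 : ℤ) ≤ a 1 ∧ a 0 ≤ L ∧ a 1 ≤ L :=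
    ⟨haQ.1 0, haQ.1 1, haQ.2 0, haQ.2 1⟩
  have ha2 : a 2 = 0 := le_antisymm haR (haQ.1 2)
  have hbR' : ¬ b 2 ≤ 0 := hbR
  obtain ⟨i, hi, hrest⟩ :=
    exists_coord_of_adj (DCT16.adj_of_openGraph_adj (Set.sdiff_subset.trans hω) hab)
  by_cases hi2 : i = 2
  swap
  · have := hrest 2 (fun h2 => hi2 h2.symm); omega
  subst hi2
  have hb0 := hrest 0 (by decide)
  have hb1 := hrest 1 (by decide)
  refine ((openGraph_adj _ _ _).1 hab).1.2 (Finset.mem_image.2 ⟨((a 0).toNat, (a 1).toNat),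
    Finset.mem_product.2 ⟨Finset.mem_range.2 (by omega), Finset.mem_range.2 (by omega)⟩, ?_⟩)
  have hu : (![((a 0).toNat : ℤ), ((a 1).toNat : ℤ), 0] : Site 3) = a := by
    ext j; fin_cases j; exacts [Int.toNat_of_nonneg ha0, Int.toNat_of_nonneg ha1, ha2.symm]
  have hv : (![((a 0).toNat : ℤ), ((a 1).toNat : ℤ), 1] : Site 3) = b := by
    ext j; fin_cases j
    · exact (Int.toNat_of_nonneg ha0).trans hb0.symm
    · exact (Int.toNat_of_nonneg ha1).trans hb1.symm
    · show (1 : ℤ) = b 2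
      omega
  rw [hu, hv]

/-- `S(L,h).toNat ≤ (L+1)²` holds `P_p`-a.s. (`sl_le_sq` on `ω ⊆ E(ℤ³)`, `setBernoulli_ae_subset`). -/
theorem sl_le_sq_ae (p : unitInterval) {h : ℕ} (hh : 1 ≤ h) (L : ℕ) :
    ∀ᵐ ω ∂(bondPercolation (zdGraph 3) p), ((S⟦L, h⟧ ω).toNat : ℝ) ≤ ((L : ℝ) + 1) ^ 2 := by
  filter_upwards [(setBernoulli_ae_subset :
    ∀ᵐ ω ∂(bondPercolation (zdGraph 3) p), ω ⊆ (zdGraph 3).edgeSet)] with ω hω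
  exact_mod_cast ENat.toNat_le_of_le_coe (sl_le_sq hh hω)

/-- **Integrability** of `ω ↦ S(L,h)(ω).toNat` under `P_p` (`h ≥ 1`): measurable and a.s. bounded. -/
theorem integrable_sl (p : unitInterval) {h : ℕ} (hh : 1 ≤ h) (L : ℕ) :
    Integrable (fun ω => ((S⟦L, h⟧ ω).toNat : ℝ)) (bondPercolation (zdGraph 3) p) :=
  Integrable.of_bound (measurable_toNat_minOpenCutIn (Set.finite_Icc _ _) _ _).aestronglyMeasurable
    _ ((sl_le_sq_ae p hh L).mono fun ω hω => by
      rwa [Real.norm_eq_abs, abs_of_nonneg (Nat.cast_nonneg _)])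

/-- `E_p[S(L,h)] ≤ E_p[S(L',h)]` for `L ≤ L'` and `h ≥ 1`. -/
theorem integral_sl_mono (p : unitInterval) {h : ℕ} (hh : 1 ≤ h) {L L' : ℕ} (hL : L ≤ L') :
    E⟦p, L, h⟧ ≤ E⟦p, L', h⟧ :=
  integral_mono (integrable_sl p hh L) (integrable_sl p hh L') fun ω =>
    Nat.cast_le.2 (ENat.toNat_le_toNat (sl_mono hL h ω) (sl_ne_top hh L' ω))

/-- **A priori bound** `E_p[S(L,h)] ≤ (L+1)²` for `h ≥ 1`. -/
theorem integral_sl_le_sq (p : unitInterval) {h : ℕ} (hh : 1 ≤ h) (L : ℕ) :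
    E⟦p, L, h⟧ ≤ ((L : ℝ) + 1) ^ 2 := by
  simpa using integral_mono_ae (integrable_sl p hh L) (integrable_const _) (sl_le_sq_ae p hh L)

-- `block_end_le`, `eq_of_blocks_meet`: adapted from Theorems/PercBudgetLadderBudgetTightnessStubSuperadditive.lean
/-- For `a < k` the `a`-th lateral block `[(L+1)a, (L+1)a+L]` ends at or before `k(L+1)-1` (in `ℤ`). -/
theorem block_end_le {L a k : ℕ} (ha : a < k) :
    (((L + 1) * a + L : ℕ) : ℤ) ≤ ((k * (L + 1) - 1 : ℕ) : ℤ) := by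
  have h1 : (L + 1) * (a + 1) ≤ (L + 1) * k := Nat.mul_le_mul_left _ ha
  rw [Nat.mul_succ] at h1
  rw [Nat.mul_comm k]
  exact Nat.cast_le.2 (by omega)

/-- Two lateral blocks `[(L+1)a, (L+1)a+L]`, `[(L+1)a', (L+1)a'+L]` sharing a point coincide. -/
theorem eq_of_blocks_meet {L a a' : ℕ} {z : ℤ} (h1 : (((L + 1) * a : ℕ) : ℤ) ≤ z)
    (h2 : z ≤ (((L + 1) * a + L : ℕ) : ℤ)) (h3 : (((L + 1) * a' : ℕ) : ℤ) ≤ z)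
    (h4 : z ≤ (((L + 1) * a' + L : ℕ) : ℤ)) : a = a' := by
  push_cast at h1 h2 h3 h4
  have hpos : (0 : ℤ) ≤ (L : ℤ) + 1 := by positivity
  have key1 : ((L : ℤ) + 1) * a < ((L : ℤ) + 1) * ((a' : ℤ) + 1) := by linarith
  have key2 : ((L : ℤ) + 1) * a' < ((L : ℤ) + 1) * ((a : ℤ) + 1) := by linarith
  have c1 := lt_of_mul_lt_mul_left key1 hpos
  have c2 := lt_of_mul_lt_mul_left key2 hpos
  omega

/-- The block `Q_{a,b}` (third coordinates `[lo, hi]`, `a, b < k`) lies in `[0, k(L+1)-1]² × [lo, hi]`. -/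
theorem block_subset {L k a b : ℕ} (ha : a < k) (hb : b < k) (lo hi : ℤ) :
    Set.Icc (![(((L + 1) * a : ℕ) : ℤ), (((L + 1) * b : ℕ) : ℤ), lo] : Site 3)
        ![(((L + 1) * a + L : ℕ) : ℤ), (((L + 1) * b + L : ℕ) : ℤ), hi] ⊆
      Set.Icc (![0, 0, lo] : Site 3)
        ![((k * (L + 1) - 1 : ℕ) : ℤ), ((k * (L + 1) - 1 : ℕ) : ℤ), hi] :=
  Set.Icc_subset_Icc (vec3_le (Nat.cast_nonneg _) (Nat.cast_nonneg _) le_rfl)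
    (vec3_le (block_end_le ha) (block_end_le hb) le_rfl)

/-- Distinct blocks (same third coordinate range) are disjoint. -/
theorem block_disjoint {L : ℕ} {ab ab' : ℕ × ℕ} (hne : ab ≠ ab') (lo hi : ℤ) :
    Disjoint (Set.Icc (![(((L + 1) * ab.1 : ℕ) : ℤ), (((L + 1) * ab.2 : ℕ) : ℤ), lo] : Site 3)
        ![(((L + 1) * ab.1 + L : ℕ) : ℤ), (((L + 1) * ab.2 + L : ℕ) : ℤ), hi])
      (Set.Icc (![(((L + 1) * ab'.1 : ℕ) : ℤ), (((L + 1) * ab'.2 : ℕ) : ℤ), lo] : Site 3)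
        ![(((L + 1) * ab'.1 + L : ℕ) : ℤ), (((L + 1) * ab'.2 + L : ℕ) : ℤ), hi]) := by
  refine Set.disjoint_left.2 fun x hx hx' => hne (Prod.ext ?_ ?_)
  · exact eq_of_blocks_meet (hx.1 0) (hx.2 0) (hx'.1 0) (hx'.2 0)
  · exact eq_of_blocks_meet (hx.1 1) (hx.2 1) (hx'.1 1) (hx'.2 1)

/-- **Pointwise lateral superadditivity** (`stub_superadditive`): `Σ_{a,b<k} S(Q_{a,b}) ≤ S(Q(k(L+1)-1,h))`. -/
theorem sum_blocks_le (L h k : ℕ) (ω : BondConfig (Site 3)) :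
    ∑ ab ∈ Finset.range k ×ˢ Finset.range k, B⟦L, h, ab.1, ab.2⟧ ω ≤ S⟦k * (L + 1) - 1, h⟧ ω := by
  refine sum_minOpenCutIn_le (fun ab hab => ?_) (fun ab hab => ?_) (fun ab hab => ?_)
    fun ab _ ab' _ hne => block_disjoint hne 0 (h : ℤ)
  all_goals obtain ⟨ha, hb⟩ := Finset.mem_product.1 hab
  · exact block_subset (Finset.mem_range.1 ha) (Finset.mem_range.1 hb) 0 (h : ℤ)
  · exact block_subset (Finset.mem_range.1 ha) (Finset.mem_range.1 hb) 0 0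
  · exact block_subset (Finset.mem_range.1 ha) (Finset.mem_range.1 hb) (h : ℤ) (h : ℤ)

/-- The block `Q_{a,b}` and its layers are the translates by `((L+1)a, (L+1)b, 0)` of `Q(L,h)`, layers. -/
theorem block_eq_image (L a b : ℕ) (lo hi : ℤ) :
    Set.Icc (![(((L + 1) * a : ℕ) : ℤ), (((L + 1) * b : ℕ) : ℤ), lo] : Site 3)
        ![(((L + 1) * a + L : ℕ) : ℤ), (((L + 1) * b + L : ℕ) : ℤ), hi] =
      (· + (![(((L + 1) * a : ℕ) : ℤ), (((L + 1) * b : ℕ) : ℤ), 0] : Site 3)) ''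
        Set.Icc (![0, 0, lo] : Site 3) ![(L : ℤ), (L : ℤ), hi] := by
  rw [Set.image_add_const_Icc]
  congr 1 <;> ext i <;> fin_cases i <;> simp <;> ring

/-- **Translation invariance of the block expectations**: `E_p[S(Q_{a,b})] = E_p[S(L,h)]`. -/
theorem integral_block (p : unitInterval) (L h a b : ℕ) :
    ∫ ω, ((B⟦L, h, a, b⟧ ω).toNat : ℝ) ∂(bondPercolation (zdGraph 3) p) = E⟦p, L, h⟧ := by
  rw [block_eq_image L a b 0 (h : ℤ), block_eq_image L a b 0 0,
    block_eq_image L a b (h : ℤ) (h : ℤ)]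
  exact integral_toNat_minOpenCutIn_shift p _ _ _ _

/-- **Lateral superadditivity in expectation** `k² E_p[S(L,h)] ≤ E_p[S(k(L+1)-1, h)]` (`h ≥ 1`). -/
theorem sq_mul_integral_le (p : unitInterval) {h : ℕ} (hh : 1 ≤ h) (k L : ℕ) :
    (k : ℝ) ^ 2 * E⟦p, L, h⟧ ≤ E⟦p, k * (L + 1) - 1, h⟧ := by
  have hpt : ∀ ω, ∑ ab ∈ Finset.range k ×ˢ Finset.range k, ((B⟦L, h, ab.1, ab.2⟧ ω).toNat : ℝ) ≤
      ((S⟦k * (L + 1) - 1, h⟧ ω).toNat : ℝ) := fun ω => by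
    have hsum := sum_blocks_le L h k ω
    have hne := sl_ne_top hh (k * (L + 1) - 1) ω
    have h1 := ENat.toNat_le_toNat hsum hne
    rw [ENat.toNat_sum (ENat.sum_ne_top.1 (ne_top_of_le_ne_top hne hsum))] at h1
    exact_mod_cast h1
  have hint : ∀ ab ∈ Finset.range k ×ˢ Finset.range k,
      Integrable (fun ω => ((B⟦L, h, ab.1, ab.2⟧ ω).toNat : ℝ)) (bondPercolation (zdGraph 3) p) :=
    fun ab hab => (integrable_sl p hh _).mono'
      (measurable_toNat_minOpenCutIn (Set.finite_Icc _ _) _ _).aestronglyMeasurable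
      (Eventually.of_forall fun ω => by
        rw [Real.norm_eq_abs, abs_of_nonneg (Nat.cast_nonneg _)]
        exact Nat.cast_le.2 (ENat.toNat_le_toNat ((Finset.single_le_sum (fun _ _ => zero_le)
          hab).trans (sum_blocks_le L h k ω)) (sl_ne_top hh _ ω)))
  calc (k : ℝ) ^ 2 * E⟦p, L, h⟧
      = ∑ ab ∈ Finset.range k ×ˢ Finset.range k,
          ∫ ω, ((B⟦L, h, ab.1, ab.2⟧ ω).toNat : ℝ) ∂(bondPercolation (zdGraph 3) p) := by
        rw [Finset.sum_congr rfl fun ab _ => integral_block p L h ab.1 ab.2, Finset.sum_const,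
          Finset.card_product, Finset.card_range, nsmul_eq_mul]
        push_cast
        ring
    _ = ∫ ω, ∑ ab ∈ Finset.range k ×ˢ Finset.range k, ((B⟦L, h, ab.1, ab.2⟧ ω).toNat : ℝ)
          ∂(bondPercolation (zdGraph 3) p) := (integral_finsetSum _ hint).symm
    _ ≤ E⟦p, k * (L + 1) - 1, h⟧ :=
        integral_mono (integrable_finsetSum _ hint) (integrable_sl p hh _) hpt

end StubTauLimit

open StubTauLimit in
/-- **`stub_tauLimit`** (registered stub of line `Sketch`, crux stmt-CriticalPhenomena-5248): for every
`p`, `h` some `τ = τ_h(p) ∈ ℝ` has `E_p[S(L,h)] ≤ τ (L+1)²` for EVERY `L` and `E_p[S(L,h)]/(L+1)² → τ`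
(Kesten's slab flow constant is a lateral limit and the supremum). `h = 0`: all budgets are `⊤`, `τ = 0`;
`h ≥ 1`: `tendsto_of_mono_superadd` with `integral_sl_mono`, `sq_mul_integral_le`, `integral_sl_le_sq`. -/
theorem stub_tauLimit :
    ∀ (p : unitInterval) (h : ℕ), ∃ τ : ℝ,
      (∀ L : ℕ, ∫ ω, ((minOpenCutIn
          (Set.Icc (![0, 0, 0] : Site 3) ![(L : ℤ), (L : ℤ), (h : ℤ)])
          (Set.Icc (![0, 0, 0] : Site 3) ![(L : ℤ), (L : ℤ), 0])
          (Set.Icc (![0, 0, (h : ℤ)] : Site 3) ![(L : ℤ), (L : ℤ), (h : ℤ)])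
          ω).toNat : ℝ) ∂(bondPercolation (zdGraph 3) p) ≤ τ * ((L : ℝ) + 1) ^ 2) ∧
      Filter.Tendsto (fun L : ℕ => (∫ ω, ((minOpenCutIn
          (Set.Icc (![0, 0, 0] : Site 3) ![(L : ℤ), (L : ℤ), (h : ℤ)])
          (Set.Icc (![0, 0, 0] : Site 3) ![(L : ℤ), (L : ℤ), 0])
          (Set.Icc (![0, 0, (h : ℤ)] : Site 3) ![(L : ℤ), (L : ℤ), (h : ℤ)])
          ω).toNat : ℝ) ∂(bondPercolation (zdGraph 3) p)) / ((L : ℝ) + 1) ^ 2)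
        Filter.atTop (nhds τ) := by
  intro p h
  rcases Nat.eq_zero_or_pos h with rfl | hh
  · have htop : ∀ (L : ℕ) (ω : BondConfig (Site 3)),
        minOpenCutIn (Set.Icc (![0, 0, 0] : Site 3) ![(L : ℤ), (L : ℤ), 0])
          (Set.Icc (![0, 0, 0] : Site 3) ![(L : ℤ), (L : ℤ), 0])
          (Set.Icc (![0, 0, 0] : Site 3) ![(L : ℤ), (L : ℤ), 0]) ω = ⊤ := fun L ω => by
      have h0 : (![0, 0, 0] : Site 3) ∈ Set.Icc (![0, 0, 0] : Site 3) ![(L : ℤ), (L : ℤ), 0] :=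
        Set.left_mem_Icc.2 (vec3_le (Nat.cast_nonneg L) (Nat.cast_nonneg L) le_rfl)
      exact (minOpenCutIn_eq_top_iff_of_finite (Set.finite_Icc _ _) _ _ ω).2 ⟨_, h0, h0, h0⟩
    refine ⟨0, fun L => ?_, ?_⟩ <;> simp [htop]
  · exact tendsto_of_mono_superadd (f := fun L => E⟦p, L, h⟧)
      (fun L => integral_nonneg fun ω => Nat.cast_nonneg _)
      (fun L L' hL => integral_sl_mono p hh hL) (fun k L => sq_mul_integral_le p hh k L)
      (integral_sl_le_sq p hh)

end Summit.CriticalPhenomena.PercolationContinuityZ3.Theorems.BudgetTightness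

end
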